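import Literature.NumberTheory.DiophantineGeometry.GeneralizedFermatTwoPowerCoefficientTateProofs
import Literature.NumberTheory.DiophantineGeometry.GeneralizedFermatTwoPowerCoefficientFreyTwoProofs
import Literature.NumberTheory.EllipticCurves.OggFormulaPotGoodOrdinaryTwoProofs
import Literature.NumberTheory.EllipticCurves.InertiaInvariantsMultiplicativeProofs
import Literature.NumberTheory.Automorphic.CDTSwanConductorProofs
import HarnessLib

/-!
# Ribet 1997, Theorem 3 along Serre's road: the Ogg–Saito input is two Swan conductors (proofs)

Topic `Literature/NumberTheory/DiophantineGeometry`; eighth sibling *proofs* file (theorems only: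
no definition, no named fact, no `sorry`) of `GeneralizedFermatTwoPowerCoefficient` (named fact
`ribet1997_twoPowerFermat`: K. Ribet, *On the equation `aᵖ + 2^α bᵖ + cᵖ = 0`*, Acta Arith. 79
(1997), Thm. 3).  After `…TateProofs`, Theorem 3 is
`ribet1997_twoPowerFermat_of_khare_wintenberger_of_mazurKenku_of_saito_of_serreWeightTwo hKW hMK hSaito hwt`
with `hSaito` = Ogg's formula for the wild conductor at the additive places of residue
characteristic `2` for **every** elliptic curve over `ℚ` and every prime `ℓ` (the named fact
`WeierstrassCurve.swanConductorAt_rationalTate_eq_wildConductorExponent_of_ringChar_eq_two`, Saito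
1988).  Ribet's proof needs that input at exactly one place of exactly one family: the place `2` of
the Frey curve `E : y² = x (x − A) (x + B)`, `A = aᵖ ≡ −1 (mod 4)`, `B = 2^α bᵖ` with
`ord₂ B ∈ {2, 3}` (Ribet 1997, §2, p. 11: "`t = 3`" — Diamond–Kramer), where `E` has additive,
potentially supersingular reduction (`ord₂ j = 8 − 2 ord₂ B > 0`) of Kodaira type `I₁*` resp.
`III*` and `f₂ = 3` (`…FreyTwoProofs`).  This file narrows the hypothesis accordingly:

* `wildConductorExponent_freyCurve_two_eq_one` (places of `ℤ`) and `…_ringOfIntegers` (places of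
  `𝓞 ℚ`): `δ₂(E) = f₂ − ε₂ = 3 − 2 = 1` for these Frey curves;
* `artinConductorExponent_tate_eq_conductorExponent_freyCurve_of_swanConductorAt_eq_one`: for such
  a Frey curve, the exponentwise Ogg–Saito statement `a_v(V_ℓ E) = f_v(E)` (all `v ∤ ℓ`, all `ℓ`)
  follows from the single value `Sw_𝔓(E[3]) = 1` at a prime `𝔓 ∣ 2` of `\bar ℤ` — by the tree's
  reduction of Saito's theorem over `ℚ` to the `3`-torsion of the potentially supersingular curves
  (`artinConductorExponent_tate_eq_conductorExponent_of_isElliptic_of_valuation_j_lt_one`,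
  `OggFormulaPotGoodOrdinaryTwoProofs`);
* `isSemistable_ringOfIntegers_of_isSemistable_int` and
  `artinConductorExponent_tate_eq_conductorExponent_freyCurve_of_sixteen_dvd`: for `16 ∣ B` the
  Frey curve is semistable and Ogg–Saito is a theorem of the tree
  (`artinConductorExponent_tate_eq_conductorExponent_of_isSemistable`);
* `serreLevel_baseChange_dvd_conductorNorm_of_artinConductorExponent`: Serre's (4.6.3)
  `N(ρ̄_{E,p} ⊗ k) ∣ N_E` for one curve from Ogg–Saito for that curve at `ℓ = p`;
* `ribet1997_twoPowerFermat_of_khare_wintenberger_of_freyLevel_local`: the Serre-road assembly of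
  `…SerreProofs` with its level hypothesis `hlevN` asked only of the Frey curves;
* `ribet1997_twoPowerFermat_of_khare_wintenberger_of_mazurKenku_of_serreWeightTwo_of_freySwan`:
  **Theorem 3 from `khare_wintenberger`, `mazurKenku_exists_cyclic_isogeny`, Serre's weight-`2`
  statement `hwt`, and the two Swan values `Sw_𝔓(E[3]) = 1` for the Frey curves with
  `ord₂ B ∈ {2, 3}`** — the classes `(ord₂ Δ, ord₂ c₄, ord₂ c₆) = (8, 4, 6)` and `(10, 4, 6)` of the
  `2`-adic classification by which the tree is discharging Saito's theorem over `ℚ`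
  (`ThreeTorsionSwanAtTwoClass…Proofs`);
* `Ribet1997.freyCurve_c₄`, `Ribet1997.freyCurve_c₆`, `Ribet1997.freyCurve_class_of_four_mul`,
  `Ribet1997.freyCurve_class_of_eight_mul`: the class data of the Frey model
  (`c₄ = 2⁴ (A² + AB + B²)`, `c₆ = −2⁵ (B − A)(2A + B)(A + 2B)`, `Δ = 2⁴ (AB(A+B))²`; for `4 ∥ B`
  resp. `8 ∥ B`: `c₄ = 2⁴ c₄'`, `c₆ = 2⁶ c₆'`, `Δ = 2⁸ Δ'` resp. `2¹⁰ Δ'` with `c₄', c₆', Δ'` odd),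
  ready to be fed to the class theorems `swanConductorAt_torsion_three_of_class_D8C4C6…` /
  `…D10C4C6…` once the tree has them.

## References

* [Ribet1997] K. A. Ribet, Acta Arith. 79 (1997), 7–16, Thm. 3, §2 (p. 11: `t = 3`), §3.
* [DiamondKramer1995] F. Diamond, K. Kramer, *Modularity of a family of elliptic curves*, Math.
  Res. Lett. 2 (1995), 299–304.
* [Serre1987] J.-P. Serre, Duke Math. J. 54 (1987), §4.1 (4.1.11)–(4.1.12), §4.6 (4.6.3).
* [SilvermanATAEC1994] J. H. Silverman, *Advanced Topics in the Arithmetic of Elliptic Curves*,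
  §IV.10 (Definition of `ε, δ, f`, Thm. IV.10.2), Thm. IV.11.1 (Ogg's formula, PDF pp. 365–366).
* [Saito1988] T. Saito, Duke Math. J. 57 (1988), Theorem 1.
-/

noncomputable section

open scoped MatrixGroups ModularForm NumberField
open CongruenceSubgroup UpperHalfPlane Polynomial

namespace Literature.NumberTheory.DiophantineGeometry

open WeierstrassCurve GaloisRepresentations EllipticCurves EllipticCurves.ModularForms
  Rat.HeightOneSpectrum IsDedekindDomain IsDedekindDomain.HeightOneSpectrum
  Literature.NumberTheory.Automorphic Literature.NumberTheory.Automorphic.BCDT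

/-! ## Part A. The Frey curve at `2` for `ord₂ B ∈ {2, 3}`: `δ₂ = 1` -/

attribute [local instance] AddSubgroup.torsionBy.zmodModule

section FreyTwo

variable {A B : ℤ}

/-- **`δ₂(E) = 1` for the Frey curve `E : y² = x (x − A) (x + B)`, `A ≡ −1 (mod 4)`, `4 ∣ B`,
`16 ∤ B`** (places of `ℤ`): the Kodaira type at `2` is `I₁*` (`4 ∥ B`) resp. `III*` (`8 ∥ B`), so
`ε₂ = 2`, and `f₂ = 3` (`kodairaSymbolAt_freyCurve_two_of_four_dvd`,
`kodairaSymbolAt_freyCurve_two_of_eight_dvd`, Tate's algorithm); `δ₂ = f₂ − ε₂ = 1`.  This is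
Ribet's "`t = 3`" (Diamond–Kramer) read as a wild exponent. [cite: Ribet1997, §2, p. 11]
[cite: SilvermanATAEC1994, §IV.10 Definition of δ (PDF p. 358)] -/
theorem wildConductorExponent_freyCurve_two_eq_one (v : HeightOneSpectrum ℤ)
    (hv : natGenerator v = 2) (h0 : A * B * (A + B) ≠ 0) (hA : A ≡ -1 [ZMOD 4]) (h4 : (4 : ℤ) ∣ B)
    (h16 : ¬ (16 : ℤ) ∣ B) : (freyCurve A B).wildConductorExponent v = 1 := by
  have hA' : 4 ∣ A + 1 := by
    have := Int.ModEq.dvd hA.symm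
    simpa [sub_neg_eq_add] using this
  obtain ⟨b₀, hb₀⟩ := h4
  unfold WeierstrassCurve.wildConductorExponent
  by_cases h2 : (2 : ℤ) ∣ b₀
  · obtain ⟨b, hb⟩ := h2
    have hbodd : ¬ (2 : ℤ) ∣ b := fun ⟨e, he⟩ ↦ h16 ⟨e, by rw [hb₀, hb, he]; ring⟩
    obtain ⟨hK, -, hf⟩ := kodairaSymbolAt_freyCurve_two_of_eight_dvd v hv h0 hA' (b := b)
      (by rw [hb₀, hb]; ring) hbodd
    rw [hK, hf]
    rfl
  · obtain ⟨hK, -, hf⟩ := kodairaSymbolAt_freyCurve_two_of_four_dvd v hv h0 hA' hb₀ h2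
    rw [hK, hf]
    rfl

/-- The same at the place of `𝓞 ℚ` above `2` (both exponents are computed in `ℚ₂`,
`wildConductorExponent_eq_of_primesEquiv_eq`). [cite: Ribet1997, §2, p. 11] -/
theorem wildConductorExponent_freyCurve_two_eq_one_ringOfIntegers (v : HeightOneSpectrum (𝓞 ℚ))
    (hv : (2 : 𝓞 ℚ) ∈ v.asIdeal) (h0 : A * B * (A + B) ≠ 0) (hA : A ≡ -1 [ZMOD 4])
    (h4 : (4 : ℤ) ∣ B) (h16 : ¬ (16 : ℤ) ∣ B) : (freyCurve A B).wildConductorExponent v = 1 := by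
  haveI := isElliptic_freyCurve h0
  set v₂ : HeightOneSpectrum ℤ := (primesEquiv (R := ℤ)).symm ⟨2, Nat.prime_two⟩ with hv₂
  have hv₂' : natGenerator v₂ = 2 :=
    Literature.NumberTheory.EllipticCurves.Rat.natGenerator_primesEquiv_symm ⟨2, Nat.prime_two⟩
  have hvv : (primesEquiv (R := ℤ) v₂ : Nat.Primes) = primesEquiv (R := 𝓞 ℚ) v := by
    apply Subtype.ext
    change natGenerator v₂ = natGenerator v
    rw [hv₂', Rat.natGenerator_eq_two hv]
  rw [← wildConductorExponent_eq_of_primesEquiv_eq v₂ v (freyCurve A B) hvv]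
  exact wildConductorExponent_freyCurve_two_eq_one v₂ hv₂' h0 hA h4 h16

/-- **Ogg–Saito for the additive Frey curves from one Swan value.**  For
`E = freyCurve A B` with `A ≡ −1 (mod 4)`, `4 ∣ B`, `16 ∤ B`, `AB(A+B) ≠ 0`: if
`Sw_𝔓(E[3]) = 1` for some prime `𝔓` of `\bar ℤ` above the place `2` of `𝓞 ℚ`, then
`a_v(V_ℓ E) = f_v(E)` at every `v ∤ ℓ`, for every prime `ℓ` (the named fact
`artinConductorExponent_tate_eq_conductorExponent_of_isElliptic E ℓ`).  Indeed `δ₂(E) = 1`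
(`wildConductorExponent_freyCurve_two_eq_one_ringOfIntegers`), so the hypothesis is Ogg's formula
`Sw_𝔓(E[3]) = δ₂(E)` at `2`, from which the tree derives the exponentwise statement at all places
(`artinConductorExponent_tate_eq_conductorExponent_of_isElliptic_of_valuation_j_lt_one`: Saito's
half of *ATAEC* IV.11.1 over `ℚ` reduced to the `3`-torsion of the potentially supersingular
curves; the `p = 3` half, IV.10.2, Kodaira–Néron and Néron–Ogg–Shafarevich are theorems).
[cite: SilvermanATAEC1994, Thm. IV.11.1 (PDF pp. 365–366) and §IV.10 (p. 358)] [cite: Saito1988, Theorem 1]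
[cite: Ribet1997, §2, p. 11] -/
theorem artinConductorExponent_tate_eq_conductorExponent_freyCurve_of_swanConductorAt_eq_one
    (h0 : A * B * (A + B) ≠ 0) (hA : A ≡ -1 [ZMOD 4]) (h4 : (4 : ℤ) ∣ B) (h16 : ¬ (16 : ℤ) ∣ B)
    (hSw : ∃ 𝔓 ∈ ((primesEquiv (R := 𝓞 ℚ)).symm ⟨2, Nat.prime_two⟩).primesAbove,
      ((freyCurve A B).torsionGaloisRep 3).swanConductorAt (𝓞 ℚ) 𝔓 = 1)
    (ℓ : ℕ) [Fact ℓ.Prime] :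
    (freyCurve A B).artinConductorExponent_tate_eq_conductorExponent_of_isElliptic ℓ := by
  refine (freyCurve A B).artinConductorExponent_tate_eq_conductorExponent_of_isElliptic_of_valuation_j_lt_one
    ℓ fun _ _ ↦ ?_
  have h2 : (2 : 𝓞 ℚ) ∈ ((primesEquiv (R := 𝓞 ℚ)).symm ⟨2, Nat.prime_two⟩).asIdeal := by
    have := (natCast_mem_asIdeal_iff_primesEquiv_eq
      ((primesEquiv (R := 𝓞 ℚ)).symm ⟨2, Nat.prime_two⟩) Nat.prime_two).mpr
      (by rw [Equiv.apply_symm_apply])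
    exact_mod_cast this
  rw [wildConductorExponent_freyCurve_two_eq_one_ringOfIntegers _ h2 h0 hA h4 h16, Nat.cast_one]
  exact hSw

/-! ## Part B. The Frey curve for `16 ∣ B`: semistable, so Ogg–Saito is a theorem -/

/-- **Semistability over `ℤ` and over `𝓞 ℚ` agree** (an elliptic curve over `ℚ`): the places of
`ℤ` and of `𝓞 ℚ` above a prime `ℓ` carry the same reduction type, both being read on the
`ℤ_ℓ`-minimal model of `E/ℚ_ℓ` (`hasGoodReductionAtPrime_iff_hasGoodReductionAt_holds`,
`…_ringOfIntegers`, and the multiplicative analogues). [folklore] -/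
theorem isSemistable_ringOfIntegers_of_isSemistable_int (W : WeierstrassCurve ℚ) [W.IsElliptic]
    (hs : W.IsSemistable ℤ) : W.IsSemistable (𝓞 ℚ) := by
  intro v'
  set ℓ : Nat.Primes := primesEquiv (R := 𝓞 ℚ) v' with hℓ_def
  haveI : Fact (ℓ : ℕ).Prime := ⟨ℓ.2⟩
  have key : ∀ (q : Nat.Primes) (_hq : primesEquiv (R := 𝓞 ℚ) v' = q),
      (haveI := Fact.mk q.2; W.HasGoodReductionAtPrime (q : ℕ)) → W.HasGoodReductionAt v' := by
    rintro q rfl hq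
    exact (hasGoodReductionAtPrime_iff_hasGoodReductionAt_ringOfIntegers (W := W) v').mp hq
  have keym : ∀ (q : Nat.Primes) (_hq : primesEquiv (R := 𝓞 ℚ) v' = q),
      (haveI := Fact.mk q.2; W.HasMultiplicativeReductionAtPrime (q : ℕ)) →
        W.HasMultiplicativeReductionAt v' := by
    rintro q rfl hq
    exact (hasMultiplicativeReductionAtPrime_iff_hasMultiplicativeReductionAt_ringOfIntegers
      (W := W) v').mp hq
  rcases hs ((primesEquiv (R := ℤ)).symm ℓ) with hg | hm
  · exact Or.inl (key ℓ rfl ((hasGoodReductionAtPrime_iff_hasGoodReductionAt_holds W ℓ).mpr hg))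
  · exact Or.inr (keym ℓ rfl
      ((hasMultiplicativeReductionAtPrime_iff_hasMultiplicativeReductionAt_holds W ℓ).mpr hm))

/-- **Ogg–Saito for the semistable Frey curves, unconditionally**: for `A ≡ −1 (mod 4)`, `16 ∣ B`,
`A, B` coprime, `AB(A+B) ≠ 0`, the Frey curve `y² = x (x − A) (x + B)` is semistable
(`isSemistable_freyCurve_of_sixteen_dvd`; Ribet 1997, §2, p. 11), and for semistable curves the
exponentwise statement `a_v(V_ℓ E) = f_v(E)` is a theorem of the tree
(`artinConductorExponent_tate_eq_conductorExponent_of_isSemistable`, *ATAEC* IV.10.2(a),(b)).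
[cite: Ribet1997, §2, p. 11] [cite: SilvermanATAEC1994, Thm. IV.10.2(a),(b) (PDF p. 358)] -/
theorem artinConductorExponent_tate_eq_conductorExponent_freyCurve_of_sixteen_dvd
    (hAB : IsCoprime A B) (h0 : A * B * (A + B) ≠ 0) (hA : A ≡ -1 [ZMOD 4]) (hB : (16 : ℤ) ∣ B)
    (ℓ : ℕ) [Fact ℓ.Prime] :
    (freyCurve A B).artinConductorExponent_tate_eq_conductorExponent_of_isElliptic ℓ := by
  refine (freyCurve A B).artinConductorExponent_tate_eq_conductorExponent_of_isSemistable ℓ ?_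
  haveI := isElliptic_freyCurve h0
  exact isSemistable_ringOfIntegers_of_isSemistable_int _
    (isSemistable_freyCurve_of_sixteen_dvd hAB h0 hA hB)

/-- **Ogg–Saito for every normalised Frey curve from the Swan values of the additive ones.**  For
`A ≡ −1 (mod 4)`, `4 ∣ B`, `A, B` coprime, `AB(A+B) ≠ 0`: granted `Sw_𝔓(E[3]) = 1` at some
`𝔓 ∣ 2` whenever moreover `16 ∤ B` (`hSw`), the exponentwise Ogg–Saito statement holds for
`E = freyCurve A B` and every `ℓ` (case `16 ∣ B`:
`artinConductorExponent_tate_eq_conductorExponent_freyCurve_of_sixteen_dvd`; case `16 ∤ B`: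
`…_of_swanConductorAt_eq_one`). [cite: Ribet1997, §2, p. 11] -/
theorem artinConductorExponent_tate_eq_conductorExponent_freyCurve_of_freySwan
    (hSw : ∀ (A B : ℤ), IsCoprime A B → A * B * (A + B) ≠ 0 → A ≡ -1 [ZMOD 4] → (4 : ℤ) ∣ B →
      ¬ (16 : ℤ) ∣ B →
        ∃ 𝔓 ∈ ((primesEquiv (R := 𝓞 ℚ)).symm ⟨2, Nat.prime_two⟩).primesAbove,
          ((freyCurve A B).torsionGaloisRep 3).swanConductorAt (𝓞 ℚ) 𝔓 = 1)
    (hAB : IsCoprime A B) (h0 : A * B * (A + B) ≠ 0) (hA : A ≡ -1 [ZMOD 4]) (h4 : (4 : ℤ) ∣ B)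
    (ℓ : ℕ) [Fact ℓ.Prime] :
    (freyCurve A B).artinConductorExponent_tate_eq_conductorExponent_of_isElliptic ℓ := by
  by_cases h16 : (16 : ℤ) ∣ B
  · exact artinConductorExponent_tate_eq_conductorExponent_freyCurve_of_sixteen_dvd hAB h0 hA h16 ℓ
  · exact artinConductorExponent_tate_eq_conductorExponent_freyCurve_of_swanConductorAt_eq_one h0 hA
      h4 h16 (hSw A B hAB h0 hA h4 h16) ℓ

end FreyTwo

/-! ## Part C. Serre's (4.6.3) for one curve -/

section Level

open GaloisRepresentations.ModPGaloisRep GaloisRepresentations.IsNonarchimedeanLocalField ValuativeRel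

/-- **`N(ρ̄_{E,p} ⊗ k) ∣ N_E` for one curve from Ogg–Saito for that curve** (Serre 1987, (4.6.3)):
the per-curve form of `serreLevel_baseChange_dvd_conductorNorm_of_tate` (`…AssemblyProofs`),
whose hypothesis was the exponentwise Ogg–Saito fact for *all* curves.  Granted
`a_v(V_p E) = f_v(E)` at the `v ∤ p` of this `E` (`hA`): `N(ρ̄ ⊗ k) ∣ N^{(p)}(V_p E)`
(`IsTorsionGaloisRep.serreLevel_baseChange_dvd_conductorNatOf`) and
`𝔣(E/ℚ) = 𝔣^{(p)}(V_p E) · v_p^{f_p}` (`conductor_eq_conductorOf_mul_of_artinConductorExponent`).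
[cite: Serre1987, §4.6, Lemme 5 (4.6.3)] [cite: SerreTate1968, §3] -/
theorem serreLevel_baseChange_dvd_conductorNorm_of_artinConductorExponent
    (W : WeierstrassCurve ℚ) [W.IsElliptic] (p : ℕ) [Fact p.Prime]
    (hA : W.artinConductorExponent_tate_eq_conductorExponent_of_isElliptic p)
    (ρ : ModPGaloisRep ℚ (ZMod p) 2) (hρ : W.IsTorsionGaloisRep p ρ)
    (k : Type*) [Field k] [TopologicalSpace k] [DiscreteTopology k] (j : ZMod p →+* k) :
    serreLevel p (FramedRep.baseChange j continuous_of_discreteTopology ρ) ∣ W.conductorNorm ℤ := by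
  have hcont := W.continuous_rationalGaloisRepTate_holds p
  have h1 := hρ.serreLevel_baseChange_dvd_conductorNatOf j continuous_of_discreteTopology hcont
  have hA' : W.artinConductorExponent_tate_eq_conductorExponent p :=
    (W.artinConductorExponent_tate_eq_conductorExponent_iff_of_isElliptic p).mpr hA
  have h2 := conductor_eq_conductorOf_mul_of_artinConductorExponent W p hA' hcont
  rw [← W.conductorNorm_ringOfIntegers_rat]
  refine h1.trans ?_
  unfold conductorNatOf WeierstrassCurve.conductorNorm
  rw [h2, map_mul]
  exact dvd_mul_right _ _

end Level

/-! ## Part D. The Serre-road assembly with Ogg–Saito asked only of the Frey curves -/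

section SerreRoad

open ValuativeRel GaloisRepresentations.ModPGaloisRep GaloisRepresentations.IsNonarchimedeanLocalField

/-- **Ribet 1997, Theorem 3 ⟸ Khare–Wintenberger ∧ the local description of `E[p]`, with the
level input asked only of the Frey curves.**  This is
`ribet1997_twoPowerFermat_of_khare_wintenberger_of_frey_local` (`…SerreProofs`, whose docstring
describes the printed proof being followed: Ribet 1997 §3 in Serre's language) with one change of
hypothesis: instead of `hlevN` — Serre's (4.6.3) `N(ρ̄_{E,p} ⊗ k) ∣ N_E` for *every* elliptic
curve over `ℚ` — it asks for the exponentwise Ogg–Saito statement `a_v(V_p E) = f_v(E)` (the named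
fact `artinConductorExponent_tate_eq_conductorExponent_of_isElliptic E p`) only for the normalised
Frey curves `E = freyCurve A B`, `A ≡ −1 (mod 4)`, `4 ∣ B`, `A, B` coprime, `AB(A+B) ≠ 0`, and
`p ≥ 5` (`hOS`), from which (4.6.3) for that curve follows
(`serreLevel_baseChange_dvd_conductorNorm_of_artinConductorExponent`).  The proof is otherwise
verbatim: normalise, frame `E[p]`, irreducible (`hirr`) and odd, Khare–Wintenberger (`hKW`) in
weight `k = 2` (`hwt`), level `N ∣ 8` (odd primes by `hTate`, `ord₂ N_E ≤ 3` by `hDK` /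
semistability), no such newform (`false_of_isGaloisRepOfNewform1Int_of_dvd_eight`).
[cite: Ribet1997, Thm. 3 and §3, p. 13] [cite: Serre1987, §4.1 (Prop. 6, (4.1.11), (4.1.12)), §4.2, (4.6.3)]
[cite: KhareWintenberger2009, Thm. 1.2 and Thm. 9.1] -/
theorem ribet1997_twoPowerFermat_of_khare_wintenberger_of_freyOggSaito_local
    (hKW : ∀ (p : ℕ) [Fact p.Prime] (k : Type) [Field k] [TopologicalSpace k] [DiscreteTopology k],
      khare_wintenberger p k)
    (hirr : ∀ (A B : ℤ) (p : ℕ), p.Prime → 5 ≤ p → IsCoprime A B → A * B * (A + B) ≠ 0 →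
      A ≡ -1 [ZMOD 4] → (2 : ℤ) ∣ B → (freyCurve A B).HasIrreducibleModPGaloisRep p)
    (hwt : ∀ (W : WeierstrassCurve ℚ) [W.IsElliptic] (p : ℕ) [Fact p.Prime], 5 ≤ p →
      W.IsSemistableAt ((primesEquiv (R := ℤ)).symm ⟨p, Fact.out⟩) →
      p ∣ W.ordMinimalDiscriminant ((primesEquiv (R := ℤ)).symm ⟨p, Fact.out⟩) →
      ∀ ρ : ModPGaloisRep ℚ (ZMod p) 2, W.IsTorsionGaloisRep p ρ →
        ∀ (k : Type) [Field k] [TopologicalSpace k] [DiscreteTopology k] [CharP k p]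
          [IsAlgClosed k] (j : ZMod p →+* k)
          (loc : LocalRestrictionAt p (FramedRep.baseChange j continuous_of_discreteTopology ρ))
          (ι : absIntegers 𝒪[loc.F] loc.F ⧸ absMaximalIdeal loc.F →+* k),
          serreWeight p (FramedRep.baseChange j continuous_of_discreteTopology ρ) loc ι = 2)
    (hOS : ∀ (A B : ℤ) (p : ℕ) [Fact p.Prime], 5 ≤ p → IsCoprime A B → A * B * (A + B) ≠ 0 →
      A ≡ -1 [ZMOD 4] → (4 : ℤ) ∣ B →
        (freyCurve A B).artinConductorExponent_tate_eq_conductorExponent_of_isElliptic p)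
    (hTate : ∀ (W : WeierstrassCurve ℚ) [W.IsElliptic] (p : ℕ) [Fact p.Prime],
      ∀ ρ : ModPGaloisRep ℚ (ZMod p) 2, W.IsTorsionGaloisRep p ρ →
        ∀ (k : Type) [Field k] [TopologicalSpace k] [DiscreteTopology k] [CharP k p]
          [IsAlgClosed k] (j : ZMod p →+* k) (v : HeightOneSpectrum ℤ),
          natGenerator v ≠ p → W.IsSemistableAt v → p ∣ W.ordMinimalDiscriminant v →
            ¬ natGenerator v ∣ serreLevel p (FramedRep.baseChange j continuous_of_discreteTopology ρ))
    (hDK : ∀ (A B : ℤ), IsCoprime A B → A * B * (A + B) ≠ 0 → A ≡ -1 [ZMOD 4] → (4 : ℤ) ∣ B →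
      ¬ (16 : ℤ) ∣ B →
        (freyCurve A B).conductorExponent ((primesEquiv (R := ℤ)).symm ⟨2, Nat.prime_two⟩) ≤ 3) :
    ribet1997_twoPowerFermat := by
  classical
  rw [ribet1997_twoPowerFermat_iff_normalized]
  intro p hp h5 r h2r hrp a b c h0 hab hac hbc ha heq
  haveI hpF : Fact p.Prime := ⟨hp⟩
  have hodd : Odd p := hp.odd_of_ne_two (by omega)
  have hp2 : p ≠ 2 := by omega
  obtain ⟨hcop, hne, hA, h4, hsum⟩ := Ribet1997.monomials hodd h2r h0 hab hac ha heq
  have hB2 : (2 : ℤ) ∣ 2 ^ r * b ^ p := dvd_trans (by norm_num) h4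
  set W : WeierstrassCurve ℚ := freyCurve (a ^ p) (2 ^ r * b ^ p) with hW
  haveI hWE : W.IsElliptic := isElliptic_freyCurve hne
  /- Step 1. A framed model `ρ̄` of `E[p]` and its extension of scalars `ρ̄' = ρ̄ ⊗ 𝔽̄_p`. -/
  haveI : NeZero ((p : ℕ) : ℚ) := ⟨by exact_mod_cast hp.ne_zero⟩
  obtain ⟨ρ, hρ⟩ := W.exists_isTorsionGaloisRep p
  letI : TopologicalSpace (AlgebraicClosure (ZMod p)) := ⊥
  haveI : DiscreteTopology (AlgebraicClosure (ZMod p)) := ⟨rfl⟩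
  set j : ZMod p →+* AlgebraicClosure (ZMod p) := algebraMap (ZMod p) (AlgebraicClosure (ZMod p))
    with hj
  set ρ' : ModPGaloisRep ℚ (AlgebraicClosure (ZMod p)) 2 :=
    FramedRep.baseChange j continuous_of_discreteTopology ρ with hρ'
  -- `ρ̄'` is irreducible (`hirr`) and odd (`det ρ̄ = χ̄_p`)
  have habs := isAbsolutelyIrreducible_of_hasIrreducibleModPGaloisRep W hp2
    (hirr _ _ p hp h5 hcop hne hA hB2) hρ
  have hirr' : ρ'.toGaloisRep.IsIrreducible := by
    rw [← ModPGaloisRep.isIrreducible_iff_toGaloisRep]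
    exact habs.isIrreducible_baseChange (AlgebraicClosure (ZMod p)) j _
  have hodd' : FramedGaloisRep.IsOdd ρ' :=
    (ModPGaloisRep.isOdd_of_det_eq_modPCyclotomicCharacterZMod ρ
      (W.det_eq_modPCyclotomicCharacter_of_isTorsionGaloisRep_holds p ρ hρ)).baseChange j _
  /- Step 2. Serre's conjecture (Khare–Wintenberger): `ρ̄'` arises from a newform `f` of weight
  `k(ρ̄')` and level `N(ρ̄')`. -/
  obtain ⟨loc⟩ := nonempty_localRestrictionAt p ρ'
  obtain ⟨ι⟩ := nonempty_ringHom_residue (k := AlgebraicClosure (ZMod p)) p loc.F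
    loc.residueFieldCard_eq
  /- Step 3. The weight is `2` (`hwt`): `E` is semistable at `p` and `p ∣ ord_p (Δ_E)`. -/
  set vp : HeightOneSpectrum ℤ := (primesEquiv (R := ℤ)).symm ⟨p, hp⟩ with hvp_def
  have hvp : natGenerator vp = p := Literature.NumberTheory.EllipticCurves.Rat.natGenerator_primesEquiv_symm ⟨p, hp⟩
  have hpord : p ∣ W.ordMinimalDiscriminant vp :=
    (Ribet1997.dvd_ordMinimalDiscriminant_of_ne_two hodd h2r h0 hab hac ha heq vp
      (by rw [hvp]; exact hp2)).2
  have hsemi : W.IsSemistableAt vp :=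
    isSemistableAt_freyCurve_holds (a ^ p) (2 ^ r * b ^ p) hcop hne vp (by rw [hvp]; exact hp2)
  have hw : (serreWeight p ρ' loc ι : ℤ) = 2 := by
    have h2 : serreWeight p ρ' loc ι = 2 :=
      hwt W p h5 hsemi hpord ρ hρ (AlgebraicClosure (ZMod p)) j loc ι
    rw [h2]; rfl
  -- the newform of (3.2.4), transported to weight `2`
  obtain ⟨f, ιf, hf, hgal⟩ := hKW p (AlgebraicClosure (ZMod p)) ρ' hirr' hodd' loc ι
  revert hgal hf ιf f
  rw [hw]
  intro f ιf hf hgal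
  /- Step 4. The level divides `8`. -/
  set N : ℕ := serreLevel p ρ' with hN_def
  have hN0 : N ≠ 0 := by
    intro h0'
    apply not_dvd_serreLevel p ρ'
    rw [← hN_def, h0']
    exact dvd_zero p
  haveI hNz : NeZero N := ⟨hN0⟩
  have hNE : N ∣ W.conductorNorm ℤ :=
    serreLevel_baseChange_dvd_conductorNorm_of_artinConductorExponent W p
      (hOS _ _ p h5 hcop hne hA h4) ρ hρ (AlgebraicClosure (ZMod p)) j
  have hN8 : N ∣ 8 := by
    refine dvd_eight_of_forall_prime hN0 hNE (conductorNorm_pos_holds W).ne' ?_ ?_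
    · -- odd primes of `N` are excluded by `hTate`
      intro q hq hqN
      by_contra hq2
      have hqp : q ≠ p := by
        rintro rfl
        exact not_dvd_serreLevel q ρ' (by rw [← hN_def]; exact hqN)
      have hqm : (q : ℤ) ∣ a ^ p * (2 ^ r * b ^ p) * (a ^ p + 2 ^ r * b ^ p) :=
        dvd_of_dvd_conductorNorm_freyCurve hcop hne hq hq2 (hqN.trans hNE)
      set u : HeightOneSpectrum ℤ := (primesEquiv (R := ℤ)).symm ⟨q, hq⟩ with hu_def
      have hu : natGenerator u = q := Literature.NumberTheory.EllipticCurves.Rat.natGenerator_primesEquiv_symm ⟨q, hq⟩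
      have hordu : p ∣ W.ordMinimalDiscriminant u :=
        (Ribet1997.dvd_ordMinimalDiscriminant_of_ne_two hodd h2r h0 hab hac ha heq u
          (by rw [hu]; exact hq2)).2
      have hsemiu : W.IsSemistableAt u :=
        isSemistableAt_freyCurve_holds (a ^ p) (2 ^ r * b ^ p) hcop hne u (by rw [hu]; exact hq2)
      have := hTate W p ρ hρ (AlgebraicClosure (ZMod p)) j u (by rw [hu]; exact hqp) hsemiu hordu
      exact this (by rw [hu]; exact hqN)
    · -- `ord₂ N_E ≤ 3`
      rcases Ribet1997.sixteen_dvd_or_odd (by omega : 4 ≤ p) b (r := r) with h16 | ⟨hbo, hr3⟩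
      · exact (factorization_conductorNorm_freyCurve_two_le_one hcop hne hA h16).trans (by norm_num)
      · rw [show (2 : ℕ) = ((⟨2, Nat.prime_two⟩ : Nat.Primes) : ℕ) from rfl,
          factorization_conductorNorm_primesEquiv_symm]
        refine hDK _ _ hcop hne hA h4 ?_
        -- `16 ∤ 2^r b^p` for `b` odd, `r ≤ 3`
        intro h16
        have hb2 : ¬ (2 : ℤ) ∣ b := Int.two_dvd_ne_zero.mpr (Int.odd_iff.mp hbo)
        have hcop2 : IsCoprime ((2 : ℤ) ^ 4) (b ^ p) :=
          ((Int.prime_two.coprime_iff_not_dvd).2 hb2).pow_left.pow_right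
        have h' : (2 : ℤ) ^ 4 ∣ 2 ^ r := hcop2.dvd_of_dvd_mul_right (by exact_mod_cast h16)
        have h'' : 2 ^ 4 ∣ 2 ^ r := by exact_mod_cast h'
        have := (Nat.pow_dvd_pow_iff_le_right one_lt_two).mp h''
        omega
  /- Step 5. The primes `q > |abc|` are primes of good reduction; conclude by
  `false_of_isGaloisRepOfNewform1Int_of_dvd_eight`. -/
  refine false_of_isGaloisRepOfNewform1Int_of_dvd_eight W h5 hρ j hN8 hf ιf hgal
    (max 2 (a * b * c).natAbs) fun q hq hqB ↦ ?_
  have hq2 : q ≠ 2 := fun h' ↦ (lt_of_le_of_lt (le_max_left _ _) hqB).ne' h'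
  have hqabc : ¬ (q : ℤ) ∣ a * b * c := by
    intro h'
    have hle : q ≤ (a * b * c).natAbs :=
      Nat.le_of_dvd (Int.natAbs_pos.mpr h0) (Int.natCast_dvd.mp h')
    exact (lt_of_le_of_lt (le_max_right _ _) hqB).not_ge hle
  refine not_dvd_conductorNorm_freyCurve_of_not_dvd hcop hne hq hq2 ?_
  -- `q ∤ AB(A+B) = -(a^p)(2^r b^p)(c^p)`
  rw [hsum]
  have hqint : Prime (q : ℤ) := Nat.prime_iff_prime_int.mp hq
  have hp0 : p ≠ 0 := hp.ne_zero
  intro h'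
  apply hqabc
  rcases hqint.dvd_or_dvd h' with h' | h'
  · rcases hqint.dvd_or_dvd h' with h' | h'
    · exact dvd_mul_of_dvd_left (dvd_mul_of_dvd_left (hqint.dvd_of_dvd_pow h') _) _
    · rcases hqint.dvd_or_dvd h' with h' | h'
      · exact absurd (eq_two_of_dvd_sixteen hq ((hqint.dvd_of_dvd_pow h').trans (by norm_num)))
          hq2
      · exact dvd_mul_of_dvd_left (dvd_mul_of_dvd_right (hqint.dvd_of_dvd_pow h') _) _
  · exact dvd_mul_of_dvd_right (hqint.dvd_of_dvd_pow (dvd_neg.mp h')) _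

/-- **Ribet 1997, Theorem 3, from `khare_wintenberger`, `mazurKenku_exists_cyclic_isogeny`,
Serre's weight-`2` statement, and two Swan conductors.**  Compared with
`ribet1997_twoPowerFermat_of_khare_wintenberger_of_mazurKenku_of_saito_of_serreWeightTwo`
(`…TateProofs`), the hypothesis `hSaito` (Ogg's formula at the additive places of residue
characteristic `2` for every elliptic curve over `ℚ` and every `ℓ`: Saito 1988) is narrowed to
`hSw`: for the Frey curves `E = freyCurve A B` with `A ≡ −1 (mod 4)`, `4 ∣ B`, `16 ∤ B`, `A, B`
coprime, `AB(A+B) ≠ 0` — additive, potentially supersingular at `2`, Kodaira types `I₁*` / `III*`,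
`f₂ = 3`, `δ₂ = 1` (Ribet 1997, §2, p. 11: "`t = 3`") — the Swan conductor of `E[3]` at some prime
`𝔓 ∣ 2` of `\bar ℤ` is `1`.  These are two instances, the classes
`(ord₂ Δ, ord₂ c₄, ord₂ c₆) = (8, 4, 6)` and `(10, 4, 6)` (`Ribet1997.freyCurve_c₄`, `freyCurve_c₆`,
`freyCurve_Δ`), of the `2`-adic classification through which the tree proves Saito's theorem over
`ℚ` (`ThreeTorsionSwanAtTwoClass…Proofs`, `OggFormulaPotGoodOrdinaryTwoProofs`).  Assembly:
`ribet1997_twoPowerFermat_of_khare_wintenberger_of_freyOggSaito_local` with `hirr` from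
`hasIrreducibleModPGaloisRep_freyCurve_of_mazurKenku`, `hOS` from
`artinConductorExponent_tate_eq_conductorExponent_freyCurve_of_freySwan`, `hTate` from
Néron–Ogg–Shafarevich (`not_dvd_serreLevel_baseChange_of_hasGoodReductionAt_int`) and the
Kodaira–Néron proof of the Tate-curve criterion
(`not_dvd_serreLevel_baseChange_of_hasMultiplicativeReductionAt_of_dvd_int`), `hDK` from Tate's
algorithm (`conductorExponent_freyCurve_two_le_three`).  Remaining hypotheses: `hKW` (named fact
`khare_wintenberger`, Khare–Wintenberger 2009 Thm. 1.2), `hMK` (named fact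
`mazurKenku_exists_cyclic_isogeny`, Mazur 1978 + Kenku), `hwt` (Serre 1987, §2.9 Prop. 5 with
(4.1.11): `k(ρ̄_{E,p} ⊗ k) = 2` at a semistable `p ≥ 5` with `p ∣ ord_p Δ_min`; not catalogued)
and `hSw`. [cite: Ribet1997, Thm. 3, §2 (p. 11) and §3 (p. 13)]
[cite: Serre1987, §2.9 Prop. 5, §4.1 (4.1.11)–(4.1.12), (4.6.3)] [cite: KhareWintenberger2009, Thm. 1.2]
[cite: SilvermanATAEC1994, Thm. IV.11.1 (PDF pp. 365–366)] [cite: Saito1988, Theorem 1] -/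
theorem ribet1997_twoPowerFermat_of_khare_wintenberger_of_mazurKenku_of_serreWeightTwo_of_freySwan
    (hKW : ∀ (p : ℕ) [Fact p.Prime] (k : Type) [Field k] [TopologicalSpace k] [DiscreteTopology k],
      khare_wintenberger p k)
    (hMK : mazurKenku_exists_cyclic_isogeny)
    (hwt : ∀ (W : WeierstrassCurve ℚ) [W.IsElliptic] (p : ℕ) [Fact p.Prime], 5 ≤ p →
      W.IsSemistableAt ((primesEquiv (R := ℤ)).symm ⟨p, Fact.out⟩) →
      p ∣ W.ordMinimalDiscriminant ((primesEquiv (R := ℤ)).symm ⟨p, Fact.out⟩) →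
      ∀ ρ : ModPGaloisRep ℚ (ZMod p) 2, W.IsTorsionGaloisRep p ρ →
        ∀ (k : Type) [Field k] [TopologicalSpace k] [DiscreteTopology k] [CharP k p]
          [IsAlgClosed k] (j : ZMod p →+* k)
          (loc : LocalRestrictionAt p (FramedRep.baseChange j continuous_of_discreteTopology ρ))
          (ι : absIntegers 𝒪[loc.F] loc.F ⧸ absMaximalIdeal loc.F →+* k),
          serreWeight p (FramedRep.baseChange j continuous_of_discreteTopology ρ) loc ι = 2)
    (hSw : ∀ (A B : ℤ), IsCoprime A B → A * B * (A + B) ≠ 0 → A ≡ -1 [ZMOD 4] → (4 : ℤ) ∣ B →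
      ¬ (16 : ℤ) ∣ B →
        ∃ 𝔓 ∈ ((primesEquiv (R := 𝓞 ℚ)).symm ⟨2, Nat.prime_two⟩).primesAbove,
          ((freyCurve A B).torsionGaloisRep 3).swanConductorAt (𝓞 ℚ) 𝔓 = 1) :
    ribet1997_twoPowerFermat := by
  refine ribet1997_twoPowerFermat_of_khare_wintenberger_of_freyOggSaito_local hKW
    (fun _ _ _ hp h5 _ h0 _ _ ↦ hasIrreducibleModPGaloisRep_freyCurve_of_mazurKenku hMK h0 hp h5)
    (fun W _ p _ h5 hs hd ρ hρ k _ _ _ _ _ j loc ι ↦ hwt W p h5 hs hd ρ hρ k j loc ι)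
    (fun A B p _ _ hcop h0 hA h4 ↦
      artinConductorExponent_tate_eq_conductorExponent_freyCurve_of_freySwan hSw hcop h0 hA h4 p)
    ?_ conductorExponent_freyCurve_two_le_three
  intro W _ p _ ρ hρ k _ _ _ _ _ j v hvp hsemi hord
  rcases hsemi with hgood | hmult
  · exact not_dvd_serreLevel_baseChange_of_hasGoodReductionAt_int W p hρ j _ v hvp hgood
  · exact not_dvd_serreLevel_baseChange_of_hasMultiplicativeReductionAt_of_dvd_int W p hρ j _ v hvp
      hmult hord

end SerreRoad

/-! ## Part E. The class data of the Frey model at `2` -/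

section ClassData

variable (A B : ℤ)

/-- `c₄` of the Frey model `y² = x (x − A) (x + B)` (`a₂ = B − A`, `a₄ = −AB`):
`c₄ = 16 (A² + AB + B²)` — for `A` odd and `4 ∣ B` this is `2⁴ · c₄'` with `c₄'` odd.
[cite: Ribet1997, §2, p. 10] -/
theorem Ribet1997.freyCurve_c₄ :
    (freyCurve A B).c₄ = 16 * ((A : ℚ) ^ 2 + A * B + B ^ 2) := by
  simp only [WeierstrassCurve.c₄, WeierstrassCurve.b₂, WeierstrassCurve.b₄, freyCurve_a₁,
    freyCurve_a₂, freyCurve_a₃, freyCurve_a₄]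
  ring

/-- `c₆` of the Frey model `y² = x (x − A) (x + B)`:
`c₆ = −32 (B − A)(2A + B)(A + 2B)` — for `A` odd and `4 ∣ B` this is `2⁶ · c₆'` with `c₆'` odd
(`ord₂ (2A + B) = 1`). [cite: Ribet1997, §2, p. 10] -/
theorem Ribet1997.freyCurve_c₆ :
    (freyCurve A B).c₆ = -32 * (((B : ℚ) - A) * (2 * A + B) * (A + 2 * B)) := by
  simp only [WeierstrassCurve.c₆, WeierstrassCurve.b₂, WeierstrassCurve.b₄, WeierstrassCurve.b₆,
    freyCurve_a₁, freyCurve_a₂, freyCurve_a₃, freyCurve_a₄, freyCurve_a₆]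
  ring

variable {A B}

/-- **The `2`-adic class of the Frey model for `4 ∥ B`**: with `B = 4b`, `A, b` odd,
`c₄ = 2⁴ c₄'`, `c₆ = 2⁶ c₆'`, `Δ = 2⁸ Δ'` with `c₄' = A² + AB + B²`, `c₆' = −(B − A)(A + 2b)(A + 2B)`,
`Δ' = (A b (A + B))²` all odd: the class `(ord₂ Δ, ord₂ c₄, ord₂ c₆) = (8, 4, 6)` (Kodaira type
`I₁*`, `f₂ = 3`; Ribet 1997, §2, p. 11). [cite: Ribet1997, §2, pp. 10–11] -/
theorem Ribet1997.freyCurve_class_of_four_mul (hA : Odd A) {b : ℤ} (hB : B = 4 * b) (hb : Odd b) :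
    (freyCurve A B).c₄ = (2 : ℚ) ^ 4 * ((A ^ 2 + A * B + B ^ 2 : ℤ) : ℚ) ∧
      (freyCurve A B).c₆ = (2 : ℚ) ^ 6 * ((-((B - A) * (A + 2 * b) * (A + 2 * B)) : ℤ) : ℚ) ∧
      (freyCurve A B).Δ = (2 : ℚ) ^ 8 * (((A * b * (A + B)) ^ 2 : ℤ) : ℚ) ∧
      Odd (A ^ 2 + A * B + B ^ 2) ∧ Odd (-((B - A) * (A + 2 * b) * (A + 2 * B))) ∧
      Odd ((A * b * (A + B)) ^ 2) := by
  refine ⟨?_, ?_, ?_, ?_, ?_, ?_⟩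
  · rw [Ribet1997.freyCurve_c₄]; push_cast; ring
  · rw [Ribet1997.freyCurve_c₆, hB]; push_cast; ring
  · rw [freyCurve_Δ, hB]; push_cast; ring
  · have hBe : Even B := ⟨2 * b, by rw [hB]; ring⟩
    have h1 : Odd (A ^ 2) := hA.pow
    have h2 : Even (A * B + B ^ 2) := by
      rw [sq]; exact (hBe.mul_left A).add (hBe.mul_left B)
    rw [show A ^ 2 + A * B + B ^ 2 = A ^ 2 + (A * B + B ^ 2) by ring]
    exact h1.add_even h2
  · rw [odd_neg]
    have hBe : Even B := ⟨2 * b, by rw [hB]; ring⟩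
    have h1 : Odd (B - A) := by
      rw [show B - A = -A + B by ring]; exact hA.neg.add_even hBe
    have h2 : Odd (A + 2 * b) := hA.add_even (even_two_mul b)
    have h3 : Odd (A + 2 * B) := hA.add_even (even_two_mul B)
    exact (h1.mul h2).mul h3
  · have hAB : Odd (A + B) := hA.add_even ⟨2 * b, by rw [hB]; ring⟩
    exact ((hA.mul hb).mul hAB).pow

/-- **The `2`-adic class of the Frey model for `8 ∥ B`**: with `B = 8b`, `A, b` odd,
`c₄ = 2⁴ c₄'`, `c₆ = 2⁶ c₆'`, `Δ = 2¹⁰ Δ'` with `c₄' = A² + AB + B²`, `c₆' = −(B − A)(A + 4b)(A + 2B)`,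
`Δ' = (A b (A + B))²` all odd: the class `(ord₂ Δ, ord₂ c₄, ord₂ c₆) = (10, 4, 6)` (Kodaira type
`III*`, `f₂ = 3`; Ribet 1997, §2, p. 11). [cite: Ribet1997, §2, pp. 10–11] -/
theorem Ribet1997.freyCurve_class_of_eight_mul (hA : Odd A) {b : ℤ} (hB : B = 8 * b) (hb : Odd b) :
    (freyCurve A B).c₄ = (2 : ℚ) ^ 4 * ((A ^ 2 + A * B + B ^ 2 : ℤ) : ℚ) ∧
      (freyCurve A B).c₆ = (2 : ℚ) ^ 6 * ((-((B - A) * (A + 4 * b) * (A + 2 * B)) : ℤ) : ℚ) ∧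
      (freyCurve A B).Δ = (2 : ℚ) ^ 10 * (((A * b * (A + B)) ^ 2 : ℤ) : ℚ) ∧
      Odd (A ^ 2 + A * B + B ^ 2) ∧ Odd (-((B - A) * (A + 4 * b) * (A + 2 * B))) ∧
      Odd ((A * b * (A + B)) ^ 2) := by
  refine ⟨?_, ?_, ?_, ?_, ?_, ?_⟩
  · rw [Ribet1997.freyCurve_c₄]; push_cast; ring
  · rw [Ribet1997.freyCurve_c₆, hB]; push_cast; ring
  · rw [freyCurve_Δ, hB]; push_cast; ring
  · have hBe : Even B := ⟨4 * b, by rw [hB]; ring⟩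
    have h1 : Odd (A ^ 2) := hA.pow
    have h2 : Even (A * B + B ^ 2) := by
      rw [sq]; exact (hBe.mul_left A).add (hBe.mul_left B)
    rw [show A ^ 2 + A * B + B ^ 2 = A ^ 2 + (A * B + B ^ 2) by ring]
    exact h1.add_even h2
  · rw [odd_neg]
    have hBe : Even B := ⟨4 * b, by rw [hB]; ring⟩
    have h1 : Odd (B - A) := by
      rw [show B - A = -A + B by ring]; exact hA.neg.add_even hBe
    have h2 : Odd (A + 4 * b) := hA.add_even ⟨2 * b, by ring⟩
    have h3 : Odd (A + 2 * B) := hA.add_even (even_two_mul B)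
    exact (h1.mul h2).mul h3
  · have hAB : Odd (A + B) := hA.add_even ⟨4 * b, by rw [hB]; ring⟩
    exact ((hA.mul hb).mul hAB).pow

end ClassData

end Literature.NumberTheory.DiophantineGeometry
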